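import Literature.NumberTheory.Automorphic.IwahoriGL   -- ★ `iwahoriGL`, `mem_iwahoriGL_iff`, `iwahoriGL_le_glInt`, `glInt`, `mem_glInt_iff`
import Literature.NumberTheory.Automorphic.ReductionTheoryGLnMinkowski   -- ★ `coe_glDiagonal_inv_mul_mul_glDiagonal_apply` (entries of `d⁻¹ g e`), ★ `glDiagonal`
import Literature.NumberTheory.Automorphic.AdicCompletionLocalField   -- ★ `ValuativeRel (v.adicCompletion K)` compatible with `Valued.v`
import Literature.NumberTheory.Automorphic.HermitianLatticesLocal   -- ★ `v_lt_one_iff` (discreteness of `ℤᵐ⁰`-valued fields)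
import Literature.GroupTheory.OrbitIndexSum   -- ★ `mem_map_conj_iff` (`g ∈ K.map (conj y) ↔ y⁻¹ g y ∈ K`)
import HarnessLib

/-!
# The Iwahori subgroup of `GL₂` is the intersection of the two vertex stabilisers: `GL₂(𝒪) ∩ d GL₂(𝒪) d⁻¹ = I`, `d = diag(1, ϖ)`

For a valued field `F` with uniformiser `ϖ` the stabilisers in `GL₂(F)` of the adjacent vertices `Λ₀ = 𝒪²` and
`Λ₁ = d Λ₀ = 𝒪 e₀ ⊕ ϖ𝒪 e₁` of the tree are `K = GL₂(𝒪)` and `K′ = d K d⁻¹`, and their intersection — the stabiliser of the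
EDGE `{Λ₀, Λ₁}` — is the Iwahori subgroup `I` of matrices in `GL₂(𝒪)` that are upper triangular mod `𝔪` (Iwahori–Matsumoto;
for `d⁻¹ g d` to be integral one needs exactly `g₁₀ ∈ ϖ𝒪 = 𝔪`).  This is the relation `I = K ∩ K′` between the three levels of
Kottwitz's Euler–Poincaré function `f_EP = 𝟙_K∕vol K + 𝟙_{K′}∕vol K′ − 𝟙_I∕vol I` [Kottwitz1988, §2]; §2 transports it to any group
mapping to `GL₂(F)` (the one-place unitary group `U(σ_w, Φ₂,w) ≤ GL₂(L_w)`: the (R2) tokens `K_w`, `K′_w`, `I_w` are the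
`subgroupOf U_w` of `GL₂(𝒪_w)`, `d GL₂(𝒪_w) d⁻¹`, `iwahoriGL 2 L_w`) and reads the uniformiser hypothesis in `ℤᵐ⁰`-valued
currency (`Valued.v ϖ = exp(−1)`) at the completions `K_v` of a number field.
-/

noncomputable section

open scoped Matrix MatrixGroups Valued

namespace Literature.NumberTheory.Automorphic

open ValuativeRel

universe u

/-! ## §1 `GL₂(𝒪) ⊓ d GL₂(𝒪) d⁻¹ = I` over a field with a valuative relation -/

section Generic

variable {F : Type u} [Field F] [ValuativeRel F]

/-- **`d⁻¹ g d ∈ M₂(𝒪)` entrywise for `g ∈ I`**, `d = diag(1, ϖ)`, `ϖ` a uniformiser (every `x` with `v x < 1` has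
`v x ≤ v ϖ`): the only constraint is `v(ϖ⁻¹ g₁₀) ≤ 1`, i.e. `g₁₀ ∈ 𝔪`. [cite: IwahoriMatsumoto1965, §2 Prop. 2.4] [cite: Kottwitz1988, §2] -/
theorem valuation_conj_glDiagonal_apply_le_one_of_mem_iwahoriGL (ϖ : Fˣ) (hϖ1 : valuation F (ϖ : F) ≤ 1)
    (hmax : ∀ x : F, valuation F x < 1 → valuation F x ≤ valuation F (ϖ : F)) {g : GL (Fin 2) F}
    (hg : g ∈ iwahoriGL 2 F) (i j : Fin 2) :
    valuation F ((((glDiagonal 2 F ![1, ϖ])⁻¹ * g * glDiagonal 2 F ![1, ϖ] : GL (Fin 2) F) :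
      Matrix (Fin 2) (Fin 2) F) i j) ≤ 1 := by
  rw [mem_iwahoriGL_iff] at hg
  have hint : ∀ i j, valuation F ((g : Matrix (Fin 2) (Fin 2) F) i j) ≤ 1 := fun i j =>
    (Valuation.mem_integer_iff _ _).mp (apply_mem_integer_of_mem_glInt hg.1 i j)
  have h10 : valuation F ((g : Matrix (Fin 2) (Fin 2) F) 1 0) ≤ valuation F (ϖ : F) :=
    hmax _ (hg.2 1 0 (by decide))
  have hϖ0 : valuation F (ϖ : F) ≠ 0 := (Valuation.ne_zero_iff _).2 ϖ.ne_zero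
  rw [coe_glDiagonal_inv_mul_mul_glDiagonal_apply ![1, ϖ] ![1, ϖ] g i j, map_mul, map_mul]
  fin_cases i <;> fin_cases j
  · simpa using hint 0 0
  · simpa using mul_le_mul' (hint 0 1) hϖ1
  · simp only [Fin.mk_one, Fin.isValue, Matrix.cons_val_one, Fin.zero_eta, Matrix.cons_val_zero,
      Units.val_one, map_one, mul_one, Units.val_inv_eq_inv_val, map_inv₀]
    rw [inv_mul_le_iff₀ (zero_lt_iff.2 hϖ0), mul_one]
    exact h10
  · simp only [Fin.mk_one, Fin.isValue, Matrix.cons_val_one, Matrix.cons_val_zero, Units.val_inv_eq_inv_val, map_inv₀]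
    rw [mul_comm ((valuation F) (ϖ : F))⁻¹, mul_assoc, inv_mul_cancel₀ hϖ0, mul_one]
    exact hint 1 1

/-- **HEAD — `GL₂(𝒪) ⊓ d GL₂(𝒪) d⁻¹ = I`** (`d = diag(1, ϖ)`, `ϖ` a uniformiser: `v ϖ < 1` and `v x < 1 → v x ≤ v ϖ`): the
intersection of the stabilisers of the two adjacent vertices `𝒪²`, `𝒪 e₀ ⊕ ϖ𝒪 e₁` of the tree of `GL₂(F)` is the Iwahori
subgroup (`⊆`: `ϖ⁻¹ g₁₀ ∈ 𝒪` forces `v g₁₀ ≤ v ϖ < 1`; `⊇`: §1 lemma for `g` and `g⁻¹ ∈ I`).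
[cite: IwahoriMatsumoto1965, §2 Prop. 2.4] [cite: Kottwitz1988, §2] -/
theorem glInt_inf_map_conj_glDiagonal_eq_iwahoriGL (ϖ : Fˣ) (hϖ : valuation F (ϖ : F) < 1)
    (hmax : ∀ x : F, valuation F x < 1 → valuation F x ≤ valuation F (ϖ : F)) :
    glInt 2 F ⊓ (glInt 2 F).map (MulAut.conj (glDiagonal 2 F ![1, ϖ])).toMonoidHom = iwahoriGL 2 F := by
  ext g
  rw [Subgroup.mem_inf, Literature.GroupTheory.mem_map_conj_iff]
  constructor
  · rintro ⟨hK, hK'⟩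
    rw [mem_iwahoriGL_iff]
    refine ⟨hK, fun i j hji => ?_⟩
    have h10 : valuation F ((((glDiagonal 2 F ![1, ϖ])⁻¹ * g * glDiagonal 2 F ![1, ϖ] : GL (Fin 2) F) :
        Matrix (Fin 2) (Fin 2) F) 1 0) ≤ 1 :=
      (Valuation.mem_integer_iff _ _).mp (apply_mem_integer_of_mem_glInt hK' 1 0)
    rw [coe_glDiagonal_inv_mul_mul_glDiagonal_apply ![1, ϖ] ![1, ϖ] g 1 0, map_mul, map_mul] at h10
    simp only [Fin.isValue, Matrix.cons_val_one, Units.val_inv_eq_inv_val, map_inv₀,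
      Matrix.cons_val_zero, Units.val_one, map_one, mul_one] at h10
    have hϖ0 : valuation F (ϖ : F) ≠ 0 := (Valuation.ne_zero_iff _).2 ϖ.ne_zero
    rw [inv_mul_le_iff₀ (zero_lt_iff.2 hϖ0), mul_one] at h10
    fin_cases i <;> fin_cases j <;> simp_all
    exact lt_of_le_of_lt h10 hϖ
  · intro hI
    have hI' : g⁻¹ ∈ iwahoriGL 2 F := inv_mem hI
    refine ⟨iwahoriGL_le_glInt 2 F hI, ?_⟩
    rw [mem_glInt_iff]
    refine ⟨fun i j => (Valuation.mem_integer_iff _ _).mpr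
      (valuation_conj_glDiagonal_apply_le_one_of_mem_iwahoriGL ϖ hϖ.le hmax hI i j), fun i j => ?_⟩
    rw [show ((glDiagonal 2 F ![1, ϖ])⁻¹ * g * glDiagonal 2 F ![1, ϖ])⁻¹ =
      (glDiagonal 2 F ![1, ϖ])⁻¹ * g⁻¹ * glDiagonal 2 F ![1, ϖ] by group]
    exact (Valuation.mem_integer_iff _ _).mpr (valuation_conj_glDiagonal_apply_le_one_of_mem_iwahoriGL ϖ hϖ.le hmax hI' i j)

/-- **Pulled back to any group over `GL₂(F)`** (`φ : G →* GL₂(F)`, e.g. the inclusion of a unitary group `U(σ, Φ₂) ≤ GL₂`):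
`φ⁻¹ GL₂(𝒪) ⊓ φ⁻¹ (d GL₂(𝒪) d⁻¹) = φ⁻¹ I`. [cite: Kottwitz1988, §2] [cite: IwahoriMatsumoto1965, §2 Prop. 2.4] -/
theorem comap_glInt_inf_comap_map_conj_glDiagonal_eq_comap_iwahoriGL {G : Type*} [Group G] (φ : G →* GL (Fin 2) F)
    (ϖ : Fˣ) (hϖ : valuation F (ϖ : F) < 1) (hmax : ∀ x : F, valuation F x < 1 → valuation F x ≤ valuation F (ϖ : F)) :
    (glInt 2 F).comap φ ⊓ ((glInt 2 F).map (MulAut.conj (glDiagonal 2 F ![1, ϖ])).toMonoidHom).comap φ =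
      (iwahoriGL 2 F).comap φ := by
  rw [← Subgroup.comap_inf, glInt_inf_map_conj_glDiagonal_eq_iwahoriGL ϖ hϖ hmax]

/-- **In a subgroup `U ≤ GL₂(F)`** (the (R2) tokens `K_U := GL₂(𝒪).subgroupOf U`, `K′_U := (d GL₂(𝒪) d⁻¹).subgroupOf U`,
`I_U := I.subgroupOf U`): **`K_U ⊓ K′_U = I_U`**. [cite: Kottwitz1988, §2] [cite: IwahoriMatsumoto1965, §2 Prop. 2.4] -/
theorem glInt_subgroupOf_inf_map_conj_glDiagonal_subgroupOf_eq (U : Subgroup (GL (Fin 2) F)) (ϖ : Fˣ)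
    (hϖ : valuation F (ϖ : F) < 1) (hmax : ∀ x : F, valuation F x < 1 → valuation F x ≤ valuation F (ϖ : F)) :
    (glInt 2 F).subgroupOf U ⊓ ((glInt 2 F).map (MulAut.conj (glDiagonal 2 F ![1, ϖ])).toMonoidHom).subgroupOf U =
      (iwahoriGL 2 F).subgroupOf U :=
  comap_glInt_inf_comap_map_conj_glDiagonal_eq_comap_iwahoriGL U.subtype ϖ hϖ hmax

/-- Hypothesis form: subgroups `C, C′, I` of any `G` over `GL₂(F)` cut out by `GL₂(𝒪)`, `d GL₂(𝒪) d⁻¹`, and the Iwahori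
satisfy `C ⊓ C′ = I`. [cite: Kottwitz1988, §2] -/
theorem inf_eq_of_mem_iff_glInt_of_mem_iff_iwahoriGL {G : Type*} [Group G] (φ : G →* GL (Fin 2) F) (ϖ : Fˣ)
    (hϖ : valuation F (ϖ : F) < 1) (hmax : ∀ x : F, valuation F x < 1 → valuation F x ≤ valuation F (ϖ : F))
    (C C' I : Subgroup G) (hC : ∀ g, g ∈ C ↔ φ g ∈ glInt 2 F)
    (hC' : ∀ g, g ∈ C' ↔ φ g ∈ (glInt 2 F).map (MulAut.conj (glDiagonal 2 F ![1, ϖ])).toMonoidHom)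
    (hI : ∀ g, g ∈ I ↔ φ g ∈ iwahoriGL 2 F) : C ⊓ C' = I := by
  have eC : C = (glInt 2 F).comap φ := Subgroup.ext fun g => by rw [hC, Subgroup.mem_comap]
  have eC' : C' = ((glInt 2 F).map (MulAut.conj (glDiagonal 2 F ![1, ϖ])).toMonoidHom).comap φ :=
    Subgroup.ext fun g => by rw [hC', Subgroup.mem_comap]
  have eI : I = (iwahoriGL 2 F).comap φ := Subgroup.ext fun g => by rw [hI, Subgroup.mem_comap]
  rw [eC, eC', eI]
  exact comap_glInt_inf_comap_map_conj_glDiagonal_eq_comap_iwahoriGL φ ϖ hϖ hmax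

end Generic

/-! ## §2 Completions of number fields: the uniformiser hypothesis in `ℤᵐ⁰` currency -/

section AdicCompletion

open IsDedekindDomain NumberField

variable {K : Type*} [Field K] [NumberField K] (v : HeightOneSpectrum (𝓞 K))

/-- At `K_v`, `Valued.v ϖ = exp(−1)` gives the two uniformiser hypotheses of §1 for the valuative relation of `K_v`
(`valuation K_v` is equivalent to `Valued.v`, Mathlib `ValuativeRel.isEquiv`; discreteness ★ `v_lt_one_iff`: an element of value
`exp(−1)` is a prime element of the discretely valued `K_v`, O'Meara §16). [cite: Omeara1963, Ch. I §16] -/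
theorem valuation_lt_one_and_forall_le_of_valued_eq_exp_neg_one (ϖ : v.adicCompletion K)
    (hϖ : Valued.v ϖ = WithZero.exp (-1 : ℤ)) :
    valuation (v.adicCompletion K) ϖ < 1 ∧
      ∀ x : v.adicCompletion K, valuation (v.adicCompletion K) x < 1 →
        valuation (v.adicCompletion K) x ≤ valuation (v.adicCompletion K) ϖ := by
  have he : (valuation (v.adicCompletion K)).IsEquiv
      (Valued.v : Valuation (v.adicCompletion K) (WithZero (Multiplicative ℤ))) :=
    ValuativeRel.isEquiv _ _
  refine ⟨?_, fun x hx => ?_⟩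
  · rw [he.lt_one_iff_lt_one, hϖ, ← WithZero.exp_zero, WithZero.exp_lt_exp]; norm_num
  · rw [he.lt_one_iff_lt_one, HermitianLattice.v_lt_one_iff] at hx
    rw [he x ϖ, hϖ]
    exact hx

/-- **`GL₂(𝒪_v) ⊓ d GL₂(𝒪_v) d⁻¹ = I` at a completion `K_v`**, `d = diag(1, ϖ)` for any unit `ϖ` of `K_v` with
`Valued.v ϖ = exp(−1)`. [cite: IwahoriMatsumoto1965, §2 Prop. 2.4] [cite: Kottwitz1988, §2] -/
theorem glInt_inf_map_conj_glDiagonal_eq_iwahoriGL_of_valued_eq (ϖ : (v.adicCompletion K)ˣ)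
    (hϖ : Valued.v (ϖ : v.adicCompletion K) = WithZero.exp (-1 : ℤ)) :
    glInt 2 (v.adicCompletion K) ⊓
        (glInt 2 (v.adicCompletion K)).map (MulAut.conj (glDiagonal 2 (v.adicCompletion K) ![1, ϖ])).toMonoidHom =
      iwahoriGL 2 (v.adicCompletion K) :=
  glInt_inf_map_conj_glDiagonal_eq_iwahoriGL ϖ (valuation_lt_one_and_forall_le_of_valued_eq_exp_neg_one v _ hϖ).1
    (valuation_lt_one_and_forall_le_of_valued_eq_exp_neg_one v _ hϖ).2

/-- **`K_U ⊓ K′_U = I_U` in any `U ≤ GL₂(K_v)`** (e.g. `U = U(σ_w, Φ₂,w)(L_w)` — the (R2) tokens `K_w`, `K′_w`, `I_w`).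
[cite: Kottwitz1988, §2] [cite: IwahoriMatsumoto1965, §2 Prop. 2.4] -/
theorem glInt_subgroupOf_inf_map_conj_glDiagonal_subgroupOf_eq_of_valued_eq (U : Subgroup (GL (Fin 2) (v.adicCompletion K)))
    (ϖ : (v.adicCompletion K)ˣ) (hϖ : Valued.v (ϖ : v.adicCompletion K) = WithZero.exp (-1 : ℤ)) :
    (glInt 2 (v.adicCompletion K)).subgroupOf U ⊓
        ((glInt 2 (v.adicCompletion K)).map (MulAut.conj (glDiagonal 2 (v.adicCompletion K) ![1, ϖ])).toMonoidHom).subgroupOf U =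
      (iwahoriGL 2 (v.adicCompletion K)).subgroupOf U :=
  glInt_subgroupOf_inf_map_conj_glDiagonal_subgroupOf_eq U ϖ
    (valuation_lt_one_and_forall_le_of_valued_eq_exp_neg_one v _ hϖ).1
    (valuation_lt_one_and_forall_le_of_valued_eq_exp_neg_one v _ hϖ).2

/-- Hypothesis form at `K_v` for any `φ : G →* GL₂(K_v)` (e.g. `G = U(Φ₂)(L⁺_v)`, `φ g = (localNonsplitEquiv … g : GL₂(L_w))`):
subgroups cut out by `GL₂(𝒪_v)`, `d GL₂(𝒪_v) d⁻¹`, `I` satisfy `C ⊓ C′ = I`. [cite: Kottwitz1988, §2] -/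
theorem inf_eq_of_mem_iff_glInt_of_mem_iff_iwahoriGL_of_valued_eq {G : Type*} [Group G]
    (φ : G →* GL (Fin 2) (v.adicCompletion K)) (ϖ : (v.adicCompletion K)ˣ)
    (hϖ : Valued.v (ϖ : v.adicCompletion K) = WithZero.exp (-1 : ℤ))
    (C C' I : Subgroup G) (hC : ∀ g, g ∈ C ↔ φ g ∈ glInt 2 (v.adicCompletion K))
    (hC' : ∀ g, g ∈ C' ↔ φ g ∈ (glInt 2 (v.adicCompletion K)).map
      (MulAut.conj (glDiagonal 2 (v.adicCompletion K) ![1, ϖ])).toMonoidHom)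
    (hI : ∀ g, g ∈ I ↔ φ g ∈ iwahoriGL 2 (v.adicCompletion K)) : C ⊓ C' = I :=
  inf_eq_of_mem_iff_glInt_of_mem_iff_iwahoriGL φ ϖ (valuation_lt_one_and_forall_le_of_valued_eq_exp_neg_one v _ hϖ).1
    (valuation_lt_one_and_forall_le_of_valued_eq_exp_neg_one v _ hϖ).2 C C' I hC hC' hI

end AdicCompletion

end Literature.NumberTheory.Automorphic

end
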